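import Literature.Analysis.FluidPDE.ClassicalSolution
import Literature.Analysis.FluidPDE.NormalisedPressure

/-!
# Tao's unconditional uniqueness of finite-energy smooth solutions (named fact)

Physical space `ℝ³ = EuclideanSpace ℝ (Fin 3)`, viscosity `ν > 0`, no force.

* T. Tao, *Localisation and compactness properties of the Navier–Stokes global regularity
  problem*, Anal. PDE 6 (2013) 25–107 = arXiv:1108.1165, **Corollary 11.4** (Unconditional
  uniqueness, p. 69): "Let `(u₀, f, T)` be smooth `H¹` data. Then there is at most one almost
  smooth finite energy solution `(u, p, u₀, f, T)` with this data and with normalised pressure."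
  Novelty stated there: no decay hypothesis on the solution beyond finite energy
  `‖u‖_{L^∞_t L²_x([0,T] × ℝ³)} < ∞` (Tao (6), p. 3 = Fefferman's (7)).

## The velocity form vendored here

The printed proof (Remark 11.3, p. 69) is: Lemma 8.1 (energy dissipation is automatic) +
Corollary 11.1 (bounded enstrophy from `H¹` data, p. 68) ⇒ the solution is `H¹`;
Corollary 4.3 (p. 28: an almost smooth `H¹` solution `(u, p)` with **arbitrary** pressure gives the
mild `H¹` solution `(u, p̃)`, `p̃ = −Δ⁻¹∂ᵢ∂ⱼ(uᵢuⱼ)`, and `∇p = ∇p̃` for a.e. `t`) ⇒ `u` is an `H¹`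
mild solution; Theorem 5.4(iii) (p. 33) ⇒ `H¹` mild solutions are unique. None of these steps
uses the pressure normalisation, which in Cor. 11.4 only serves to make "at most one `(u, p)`"
literally true (the pressure-shift symmetry (32), p. 22, otherwise produces `p + C(t)`).
We therefore state the corollary for the **velocity** only, with both pressures free; this is
the form consumed by Clay-class uniqueness (`X5b` of route `NavierStokesRegularity/Blowup`) and
it needs no Riesz-transform pressure notion.

Hypotheses are rendered with the accepted `Fluid.IsClassicalNSSolutionOn (Icc 0 T)` (jointly
`C^∞` on `[0,T] × ℝ³`, i.e. Tao-*smooth*, a sub-class of almost smooth: p. 8), finite energy as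
`sup_{t ∈ [0,T]} ∫ |u(t)|² < ∞` (Tao (6)), and smooth `H¹` data as `u₀, ∇u₀ ∈ L²` (smoothness of
`u₀ = u(0)` is automatic). General `ν > 0` from `ν = 1` by the scaling (31), p. 22 / footnote 3.

## The verbatim form (fact item `wi-04751`)

`tao_unconditional_uniqueness` is Corollary 11.4 as printed: the same hypotheses plus
"with normalised pressure" for both solutions, rendered as `Literature.NS.HasNormalisedPressure u p
(Icc 0 T)` and `Literature.NS.HasNormalisedPressure v q (Icc 0 T)` (for every `t ∈ [0,T]`,
`p(t) = -Δ⁻¹∂ᵢ∂ⱼ(uᵢuⱼ)(t) + c(t)`; the constant `c(t)` is the pressure-shift symmetry (32) and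
does not affect `∇p`), conclusion `u(t) = v(t)` on `[0,T]`. It follows from the velocity form
by discarding the two normalisation hypotheses: `tao_unconditional_uniqueness.of_velocity`
(PROVED). Consumer: X5b `stmt-NavierStokesRegularity-0153` (routes Blowup, CertifiedBlowup).

## References

* T. Tao, *Localisation and compactness properties of the Navier–Stokes global regularity
  problem*, Anal. PDE 6 (2013) 25–107 = arXiv:1108.1165: Cor. 11.4 and Remark 11.3 (p. 69),
  Cor. 11.1 (p. 68), Lemma 8.1, Cor. 4.3 (p. 28), Thm. 5.4 (iii) (p. 33), Lemma 4.1 (i) and (40)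
  (pp. 24–25), (6) (p. 3), (31)–(32) (p. 22). Bib key `Tao2011`.
-/

open MeasureTheory Set
open scoped ENNReal ContDiff

namespace Literature.Analysis.FluidPDE

/-- **Tao 2011, Corollary 11.4 (Unconditional uniqueness), velocity form.** Let `ν > 0`,
`0 < T < ∞`, and let `u₀ : ℝ³ → ℝ³` have `u₀ ∈ L²`, `∇u₀ ∈ L²` (`H¹` data). If `(u, p)` and
`(v, q)` are classical solutions of the unforced Navier–Stokes system, jointly smooth on
`[0, T] × ℝ³`, with `u(0) = v(0) = u₀` and finite energy
`sup_{t ∈ [0,T]} ∫ |u(t)|² < ∞`, `sup_{t ∈ [0,T]} ∫ |v(t)|² < ∞` (no further decay assumed), then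
`u(t) = v(t)` for every `t ∈ [0, T]`. (Printed for `ν = 1` and almost smooth solutions with
normalised pressure; the proof, Remark 11.3 = Lemma 8.1 + Cor. 11.1 + Cor. 4.3 + Thm. 5.4(iii),
compares velocities for arbitrary smooth pressures, and `ν > 0` follows by the scaling (31).)
[cite: Tao2011, Cor. 11.4] -/
def tao_unconditional_uniqueness_velocity : Prop :=
  ∀ (ν T : ℝ), 0 < ν → 0 < T →
    ∀ (u₀ : EuclideanSpace ℝ (Fin 3) → EuclideanSpace ℝ (Fin 3)),
      MemLp u₀ 2 volume → MemLp (fderiv ℝ u₀) 2 volume →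
    ∀ (u v : ℝ → EuclideanSpace ℝ (Fin 3) → EuclideanSpace ℝ (Fin 3))
      (p q : ℝ → EuclideanSpace ℝ (Fin 3) → ℝ),
      FluidPDE.IsClassicalNSSolutionOn (Icc 0 T) ν 0 u p →
      FluidPDE.IsClassicalNSSolutionOn (Icc 0 T) ν 0 v q →
      u 0 = u₀ → v 0 = u₀ →
      (∃ C : ℝ≥0∞, C < ⊤ ∧ ∀ t ∈ Icc 0 T, ∫⁻ x, ‖u t x‖ₑ ^ 2 ≤ C) →
      (∃ C : ℝ≥0∞, C < ⊤ ∧ ∀ t ∈ Icc 0 T, ∫⁻ x, ‖v t x‖ₑ ^ 2 ≤ C) →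
      ∀ t ∈ Icc 0 T, u t = v t

/-- **Tao 2011, Corollary 11.4 (Unconditional uniqueness), as printed.** Let `ν > 0`,
`0 < T < ∞`, and let `u₀ : ℝ³ → ℝ³` be smooth `H¹` data (`u₀ ∈ L²`, `∇u₀ ∈ L²`). Then there is at
most one finite-energy smooth solution on `[0, T] × ℝ³` with datum `u₀` **and with normalised
pressure**: if `(u, p)` and `(v, q)` are classical solutions of the unforced Navier–Stokes system,
jointly smooth on `[0, T] × ℝ³`, with `u(0) = v(0) = u₀`, finite energy
`sup_{t ∈ [0,T]} ∫ |u(t)|² < ∞`, `sup_{t ∈ [0,T]} ∫ |v(t)|² < ∞`, and both pressures normalised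
(`p(t) = -Δ⁻¹∂ᵢ∂ⱼ(uᵢuⱼ)(t) + c(t)`, `q(t) = -Δ⁻¹∂ᵢ∂ⱼ(vᵢvⱼ)(t) + c'(t)` for every `t ∈ [0,T]`,
`Literature.Analysis.FluidPDE.HasNormalisedPressure`; the constants are the pressure-shift symmetry (32) and do not
affect `∇p`), then `u(t) = v(t)` for every `t ∈ [0, T]`. (Printed for `ν = 1` and the larger
almost smooth class; `ν > 0` by the scaling (31). Equality of the pressures up to `c(t) - c'(t)`
is then immediate from the two normalisations and is not restated.) Nothing asserted; implied by
the velocity form (`tao_unconditional_uniqueness.of_velocity`). [cite: Tao2011, Cor. 11.4] -/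
def tao_unconditional_uniqueness : Prop :=
  ∀ (ν T : ℝ), 0 < ν → 0 < T →
    ∀ (u₀ : EuclideanSpace ℝ (Fin 3) → EuclideanSpace ℝ (Fin 3)),
      MemLp u₀ 2 volume → MemLp (fderiv ℝ u₀) 2 volume →
    ∀ (u v : ℝ → EuclideanSpace ℝ (Fin 3) → EuclideanSpace ℝ (Fin 3))
      (p q : ℝ → EuclideanSpace ℝ (Fin 3) → ℝ),
      FluidPDE.IsClassicalNSSolutionOn (Icc 0 T) ν 0 u p →
      FluidPDE.IsClassicalNSSolutionOn (Icc 0 T) ν 0 v q →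
      u 0 = u₀ → v 0 = u₀ →
      (∃ C : ℝ≥0∞, C < ⊤ ∧ ∀ t ∈ Icc 0 T, ∫⁻ x, ‖u t x‖ₑ ^ 2 ≤ C) →
      (∃ C : ℝ≥0∞, C < ⊤ ∧ ∀ t ∈ Icc 0 T, ∫⁻ x, ‖v t x‖ₑ ^ 2 ≤ C) →
      HasNormalisedPressure u p (Icc 0 T) → HasNormalisedPressure v q (Icc 0 T) →
      ∀ t ∈ Icc 0 T, u t = v t

/-- The velocity form of Cor. 11.4 implies the printed form (drop the two pressure-normalisation
hypotheses). PROVED. [cite: Tao2011, Cor. 11.4] -/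
theorem tao_unconditional_uniqueness.of_velocity (h : tao_unconditional_uniqueness_velocity) :
    tao_unconditional_uniqueness :=
  fun ν T hν hT u₀ h₀ h₁ u v p q hu hv hu0 hv0 hEu hEv _ _ ↦
    h ν T hν hT u₀ h₀ h₁ u v p q hu hv hu0 hv0 hEu hEv

/-- Two normalised pressures of the same velocity field differ, at each time `t ∈ S`, by a
constant in `x` (the pressure-shift symmetry (32) is the only freedom left by the
normalisation). PROVED. [cite: Tao2011, (32)] -/
theorem HasNormalisedPressure.sub_eq_const {E : Type*} [NormedAddCommGroup E]
    [InnerProductSpace ℝ E] [FiniteDimensional ℝ E] [MeasurableSpace E] [BorelSpace E]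
    {u : ℝ → E → E} {p q : ℝ → E → ℝ} {S : Set ℝ}
    (hp : HasNormalisedPressure u p S) (hq : HasNormalisedPressure u q S) :
    ∀ t ∈ S, ∃ c : ℝ, ∀ x, p t x - q t x = c := by
  intro t ht
  obtain ⟨a, ha⟩ := hp t ht
  obtain ⟨b, hb⟩ := hq t ht
  exact ⟨a - b, fun x ↦ by rw [ha x, hb x]; ring⟩

end Literature.Analysis.FluidPDE
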